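import Mathlib.Topology.Algebra.Group.Compact
import Mathlib.Topology.Algebra.OpenSubgroup
import Mathlib.Algebra.Group.Subgroup.Pointwise
import HarnessLib

/-!
# Estrangement in depth: disjoint conjugates in a compact group stay uniformly apart at finite level
# (toolkit for [SemiAnbd] Thm 3.7 (iii) beyond finite semi-graphs)

Mochizuki, *Semi-graphs of Anabelioids*, Publ. RIMS **42** (2006) 221–322, Definition 2.4 (iv) p. 26
("estranged": `Π_b ∩ g·Π_{b'}·g⁻¹ = 1`) and the proof of Theorem 3.7 (iii) p. 41 with the author's
*Comments* (2020) (6)(b) [cite: MochizukiSemiAnbd2006, Def 2.4(iv) p.26].  Generic, Mathlib-only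
compactness facts (cell abc-iut, layer L3, GAP row G-t6g3-2b «no escape», binder `hbdd`; seat
abc-iut-w6-d062, brick B1a of the desk memo HOME/staging/w6/w6-d062/HBDD-LOCFIN-memo.md, §2 «depth
lemma»).  Print's estrangement is an EXACT statement in the profinite vertex group `Π_w`; at a FINITE
level `Π_w/N` the images of `Π_b` and of a conjugate `m·Π_{b'}·m⁻¹` may well meet.  The lemmas here say
that they meet only NEAR THE IDENTITY, uniformly in the conjugator `m` ranging over a compact set on
which the exact intersections are trivial — the quantitative form of estrangement used by the memo's
two-level depth lemma (an element fixing, deep in the tower, two tree edges at a vertex whose images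
at a reference level differ is trivial at any prescribed shallower level):

* `exists_nhds_of_conj_disjoint` — `M, A, B` compact in a Hausdorff topological group with
  `A ∩ m B m⁻¹ ⊆ {1}` for all `m ∈ M`: for every neighbourhood `W` of `1` there is a neighbourhood `V`
  of `1` such that `a⁻¹·(m b m⁻¹) ∈ V` (with `m ∈ M`, `a ∈ A`, `b ∈ B`) forces `a ∈ W` (the continuous
  map `(m,a,b) ↦ a⁻¹ m b m⁻¹` on the compact set `{a ∉ W}` misses `1`, hence misses a neighbourhood);
* `exists_nhds_forall_subgroup_mul_inter_mul_subset` — the LEVEL form: for an open subgroup `U` there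
  is a neighbourhood `V` of `1` such that for EVERY subgroup `N ⊆ V` and every `m ∈ M`,
  `A·N ∩ (m B m⁻¹)·N ⊆ U`;
* `conj_disjoint_of_inf_map_conj_eq_bot` — the hypothesis from the tree's phrasing of estrangement,
  `A ⊓ B.map (MulAut.conj m) = ⊥`;
* `isCompact_compl_mul_of_isOpen` — in a compact group the typical conjugator range
  `M = (A·N₀)ᶜ` (`N₀` an open subgroup: "the two edges are distinct at the reference level") is compact.

Nothing here takes a side on [IUTchIII] Cor. 3.12; nothing here is specific to semi-graphs.
-/

namespace Literature.GroupTheory.EstrangementDepth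

open Topology
open scoped Pointwise

universe u

variable {G : Type u} [Group G] [TopologicalSpace G] [IsTopologicalGroup G]

/-- **Disjoint conjugates stay apart near infinity, uniformly in the conjugator.**  Let `M, A, B` be
compact subsets of a Hausdorff topological group with `a = m b m⁻¹ ⇒ a = 1` for `m ∈ M`, `a ∈ A`,
`b ∈ B` (estrangement along `M`).  Then for every neighbourhood `W` of `1` there is a neighbourhood `V`
of `1` such that `a⁻¹ (m b m⁻¹) ∈ V` forces `a ∈ W`.  [cite: MochizukiSemiAnbd2006, Def 2.4(iv) p.26] -/
theorem exists_nhds_of_conj_disjoint [T2Space G] {M A B : Set G} (hM : IsCompact M) (hA : IsCompact A)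
    (hB : IsCompact B) (hest : ∀ m ∈ M, ∀ a ∈ A, ∀ b ∈ B, a = m * b * m⁻¹ → a = 1)
    {W : Set G} (hW : W ∈ 𝓝 (1 : G)) :
    ∃ V ∈ 𝓝 (1 : G), ∀ m ∈ M, ∀ a ∈ A, ∀ b ∈ B, a⁻¹ * (m * b * m⁻¹) ∈ V → a ∈ W := by
  obtain ⟨W₀, hW₀W, hW₀open, hW₀1⟩ := mem_nhds_iff.mp hW
  -- the compact set of triples with `a ∉ W₀`
  let C : Set (G × G × G) := (M ×ˢ (A ×ˢ B)) ∩ {p | p.2.1 ∈ W₀ᶜ}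
  have hC : IsCompact C :=
    (hM.prod (hA.prod hB)).inter_right
      ((hW₀open.isClosed_compl).preimage (continuous_fst.comp continuous_snd))
  -- the map `(m, a, b) ↦ a⁻¹ (m b m⁻¹)`
  let φ : G × G × G → G := fun p => p.2.1⁻¹ * (p.1 * p.2.2 * p.1⁻¹)
  have hφ : Continuous φ := by
    apply Continuous.mul
    · exact (continuous_fst.comp continuous_snd).inv
    · exact ((continuous_fst.mul (continuous_snd.comp continuous_snd)).mul continuous_fst.inv)
  have hK : IsClosed (φ '' C) := (hC.image hφ).isClosed
  have h1 : (1 : G) ∉ φ '' C := by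
    rintro ⟨⟨m, a, b⟩, ⟨⟨hm, ha, hb⟩, haW⟩, h⟩
    have hab : a = m * b * m⁻¹ := by
      have : a⁻¹ * (m * b * m⁻¹) = 1 := h
      rw [inv_mul_eq_one] at this
      exact this
    have ha1 : a = 1 := hest m hm a ha b hb hab
    exact haW (by rw [ha1]; exact hW₀1)
  refine ⟨(φ '' C)ᶜ, hK.isOpen_compl.mem_nhds h1, fun m hm a ha b hb hV => ?_⟩
  by_contra haW
  exact hV ⟨⟨m, a, b⟩, ⟨⟨hm, ha, hb⟩, fun h => haW (hW₀W h)⟩, rfl⟩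

/-- **The level form.**  With `M, A, B` as above and `U` an OPEN SUBGROUP, there is a neighbourhood `V`
of `1` such that for EVERY subgroup `N` contained in `V` and every `m ∈ M`:
`A·N ∩ (m B m⁻¹)·N ⊆ U` — two "thickened" conjugates that are exactly disjoint meet only inside `U`
once the thickening is fine enough, uniformly in `m`.  (In the tower: `N = N_{w,j'}` the level-`j'`
kernel, `U = N_{w,j₀}`.) [cite: MochizukiSemiAnbd2006, Thm 3.7(iii) p.41] -/
theorem exists_nhds_forall_subgroup_mul_inter_mul_subset [T2Space G] {M A B : Set G} (hM : IsCompact M)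
    (hA : IsCompact A) (hB : IsCompact B) (hest : ∀ m ∈ M, ∀ a ∈ A, ∀ b ∈ B, a = m * b * m⁻¹ → a = 1)
    (U : Subgroup G) (hU : (U : Set G) ∈ 𝓝 (1 : G)) :
    ∃ V ∈ 𝓝 (1 : G), ∀ N : Subgroup G, (N : Set G) ⊆ V → ∀ m ∈ M, ∀ y : G,
      y ∈ A * (N : Set G) → y ∈ ((fun b => m * b * m⁻¹) '' B) * (N : Set G) → y ∈ (U : Set G) := by
  obtain ⟨V₁, hV₁, h⟩ := exists_nhds_of_conj_disjoint hM hA hB hest hU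
  refine ⟨V₁ ∩ U, Filter.inter_mem hV₁ hU, fun N hN m hm y hyA hyB => ?_⟩
  obtain ⟨a, ha, ν, hν, rfl⟩ := Set.mem_mul.mp hyA
  obtain ⟨c, ⟨b, hb, rfl⟩, ν', hν', hy⟩ := Set.mem_mul.mp hyB
  -- `a⁻¹ (m b m⁻¹) = ν ν'⁻¹ ∈ N ⊆ V₁`
  have hy' : m * b * m⁻¹ * ν' = a * ν := hy
  have hq : a⁻¹ * (m * b * m⁻¹) = ν * ν'⁻¹ := by
    have h2 : m * b * m⁻¹ = a * ν * ν'⁻¹ := eq_mul_inv_of_mul_eq hy'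
    rw [h2, mul_assoc, inv_mul_cancel_left]
  have hqN : a⁻¹ * (m * b * m⁻¹) ∈ (N : Set G) := by
    rw [hq]; exact N.mul_mem hν (N.inv_mem hν')
  have haU : a ∈ (U : Set G) := h m hm a ha b hb (hN hqN).1
  exact U.mul_mem haU (hN hν).2

omit [TopologicalSpace G] [IsTopologicalGroup G] in
/-- The estrangement hypothesis in the tree's phrasing ([SemiAnbd] Def. 2.4 (iv):
`Π_b ⊓ g Π_{b'} g⁻¹ = ⊥`) gives the pointwise form used above. [cite: MochizukiSemiAnbd2006, Def 2.4(iv) p.26] -/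
theorem conj_disjoint_of_inf_map_conj_eq_bot (A B : Subgroup G) (M : Set G)
    (h : ∀ m ∈ M, A ⊓ B.map (MulAut.conj m).toMonoidHom = ⊥) :
    ∀ m ∈ M, ∀ a ∈ (A : Set G), ∀ b ∈ (B : Set G), a = m * b * m⁻¹ → a = 1 := by
  intro m hm a ha b hb hab
  have hmem : a ∈ A ⊓ B.map (MulAut.conj m).toMonoidHom :=
    ⟨ha, ⟨b, hb, by rw [hab]; rfl⟩⟩
  rw [h m hm] at hmem
  exact (Subgroup.mem_bot.mp hmem)

/-- In a compact group, the complement of `A·N₀` for an open subgroup `N₀` is compact — the typical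
conjugator range "distinct at the reference level" of the depth lemma. [cite: MochizukiSemiAnbd2006, Thm 3.7(iii) p.41] -/
theorem isCompact_compl_mul_of_isOpen [CompactSpace G] (A : Set G) (N₀ : Subgroup G)
    (hN₀ : IsOpen (N₀ : Set G)) : IsCompact (A * (N₀ : Set G))ᶜ :=
  (hN₀.mul_left.isClosed_compl).isCompact


/-! ### Levels: a separating directed family of open subgroups is a neighbourhood basis in a compact group -/

/-- **A downward-directed family of open subgroups with trivial intersection is a neighbourhood basis of
`1` in a compact group**: every neighbourhood of `1` contains some member (the closed sets `N_i ∖ V` are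
directed with empty intersection in a compact space).  (In the tower: the level kernels `N_{w,n}` of
`Π_w`, separating by faithfulness (I0v).) [cite: MochizukiSemiAnbd2006, Thm 3.7(iii) p.41] -/
theorem exists_coe_subset_of_forall_mem_imp_eq_one [CompactSpace G] {ι : Type*} [Nonempty ι]
    (N : ι → Subgroup G) (hopen : ∀ i, IsOpen (N i : Set G))
    (hdir : ∀ i j, ∃ k, N k ≤ N i ∧ N k ≤ N j) (hbot : ∀ g : G, (∀ i, g ∈ N i) → g = 1)
    {V : Set G} (hV : V ∈ 𝓝 (1 : G)) : ∃ i, (N i : Set G) ⊆ V := by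
  obtain ⟨V₀, hV₀V, hV₀open, hV₀1⟩ := mem_nhds_iff.mp hV
  -- the closed sets `N i ∖ V₀`
  have hclosed : ∀ i, IsClosed ((N i : Set G) ∩ V₀ᶜ) := fun i =>
    ((N i).isClosed_of_isOpen (hopen i)).inter hV₀open.isClosed_compl
  have hdir' : Directed (· ⊇ ·) (fun i => (N i : Set G) ∩ V₀ᶜ) := by
    intro i j
    obtain ⟨k, hki, hkj⟩ := hdir i j
    exact ⟨k, fun x hx => ⟨hki hx.1, hx.2⟩, fun x hx => ⟨hkj hx.1, hx.2⟩⟩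
  have hempty : (Set.univ : Set G) ∩ ⋂ i, ((N i : Set G) ∩ V₀ᶜ) = ∅ := by
    rw [Set.univ_inter, Set.eq_empty_iff_forall_notMem]
    intro g hg
    rw [Set.mem_iInter] at hg
    have hg1 : g = 1 := hbot g fun i => (hg i).1
    obtain ⟨i⟩ := ‹Nonempty ι›
    exact (hg i).2 (by rw [hg1]; exact hV₀1)
  obtain ⟨i, hi⟩ := isCompact_univ.elim_directed_family_closed _ hclosed hempty hdir'
  refine ⟨i, fun x hx => ?_⟩
  by_contra hxV
  have : x ∈ (Set.univ : Set G) ∩ ((N i : Set G) ∩ V₀ᶜ) := ⟨trivial, hx, fun h => hxV (hV₀V h)⟩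
  rw [hi] at this
  exact this

/-- **The depth lemma's algebraic core, level-indexed.**  `G` a compact Hausdorff group, `M, A, B` compact
with `a = m b m⁻¹ ⇒ a = 1` along `M`, `(N_i)` a downward-directed separating family of open subgroups,
`i₀` a level.  Then there is a level `i₁` such that for every level `i` with `N_i ≤ N_{i₁}` and every
`m ∈ M`: `A·N_i ∩ (m B m⁻¹)·N_i ⊆ N_{i₀}` — at deep levels the thickened branch images meet only inside
the prescribed shallow kernel, uniformly in the conjugator.
[cite: MochizukiSemiAnbd2006, Thm 3.7(iii) p.41] -/
theorem exists_level_mul_inter_mul_subset [CompactSpace G] [T2Space G] {ι : Type*} [Nonempty ι]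
    (N : ι → Subgroup G) (hopen : ∀ i, IsOpen (N i : Set G))
    (hdir : ∀ i j, ∃ k, N k ≤ N i ∧ N k ≤ N j) (hbot : ∀ g : G, (∀ i, g ∈ N i) → g = 1)
    {M A B : Set G} (hM : IsCompact M) (hA : IsCompact A) (hB : IsCompact B)
    (hest : ∀ m ∈ M, ∀ a ∈ A, ∀ b ∈ B, a = m * b * m⁻¹ → a = 1) (i₀ : ι) :
    ∃ i₁, ∀ i, N i ≤ N i₁ → ∀ m ∈ M, ∀ y : G,
      y ∈ A * (N i : Set G) → y ∈ ((fun b => m * b * m⁻¹) '' B) * (N i : Set G) → y ∈ (N i₀ : Set G) := by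
  obtain ⟨V, hV, h⟩ := exists_nhds_forall_subgroup_mul_inter_mul_subset hM hA hB hest (N i₀)
    ((hopen i₀).mem_nhds (N i₀).one_mem)
  obtain ⟨i₁, hi₁⟩ := exists_coe_subset_of_forall_mem_imp_eq_one N hopen hdir hbot hV
  exact ⟨i₁, fun i hi m hm y hyA hyB => h (N i) (fun x hx => hi₁ (hi hx)) m hm y hyA hyB⟩

end Literature.GroupTheory.EstrangementDepth
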